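import Mathlib
import Literature.Probability.LatticeModels.ScalingLimit
import Literature.Probability.LatticeModels.ThermodynamicLimit

/-!
# Lattice sums as integrals over `ℝ³` (mesh cells), I

Support file for item `DilutionTransfer` (stmt-CriticalPhenomena-6037) of route
`HarmonicMomentsIsotropy` (sub-problem `Ising3DConformalLimit`).

With the mesh-`δ` rounding `z ↦ [z/δ] = latticeApprox δ z ∈ ℤ³` of the scaling-limit prelude
(`Literature.Probability.LatticeModels.latticeApprox`), viewed on `ℝ³ = Fin 3 → ℝ` (sup norm,
product Lebesgue measure):
* `measurable_floorMap`, `floorMap_preimage_singleton`, `volume_floorMap_preimage_singleton` — the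
  cells `{z : [z/δ] = x} = ∏ᵢ [δxᵢ, δ(xᵢ+1))` have volume `δ³`;
* `map_floorMap_volume` — the push-forward of Lebesgue measure is `δ³ ·` counting measure, hence
* `integral_comp_floorMap` — **`∫ f([z/δ]) dz = δ³ ∑ₓ f(x)`** for absolutely summable `f : ℤ³ → ℝ`;
* `norm_smul_floorMap_sub_le` — `‖δ[z/δ] - z‖_∞ ≤ δ`;
* `finite_smul_mem_closedBall`, `summable_indicator_closedBall_mul` — finiteness of lattice points
  in a bounded region.

Elementary measure theory on top of Mathlib; no Ising input.
-/

noncomputable section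

open MeasureTheory Filter Topology Set
open scoped ENNReal NNReal BigOperators
open Literature.Probability.LatticeModels

namespace Summit.CriticalPhenomena.Ising3DConformalLimit.Theorems.HarmonicMomentsIsotropy.LatticeSums

/-- The mesh-`δ` rounding of `z ∈ ℝ³` to the lattice, `[z/δ]ᵢ = ⌊zᵢ/δ⌋` (the prelude's
`latticeApprox` read on `Fin 3 → ℝ`). -/
theorem latticeApprox_toLp_apply (δ : ℝ) (z : Fin 3 → ℝ) (i : Fin 3) :
    latticeApprox δ (WithLp.toLp 2 z) i = ⌊z i / δ⌋ := by
  rw [latticeApprox_apply, PiLp.toLp_apply]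

/-- The rounding map is measurable. -/
theorem measurable_floorMap (δ : ℝ) :
    Measurable fun z : Fin 3 → ℝ => latticeApprox δ (WithLp.toLp 2 z) := by
  refine measurable_pi_iff.2 fun i => ?_
  have : (fun z : Fin 3 → ℝ => latticeApprox δ (WithLp.toLp 2 z) i) = fun z => ⌊z i / δ⌋ := by
    funext z; rw [latticeApprox_toLp_apply]
  rw [this]
  exact Int.measurable_floor.comp ((measurable_pi_apply (X := fun _ : Fin 3 => ℝ) i).div_const δ)

/-- The cell of a lattice point: `{z : [z/δ] = x} = ∏ᵢ [δ xᵢ, δ (xᵢ + 1))` for `δ > 0`. -/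
theorem floorMap_preimage_singleton {δ : ℝ} (hδ : 0 < δ) (x : Site 3) :
    (fun z : Fin 3 → ℝ => latticeApprox δ (WithLp.toLp 2 z)) ⁻¹' {x} =
      Set.pi univ fun i => Ico (δ * x i) (δ * (x i + 1)) := by
  ext z
  simp only [mem_preimage, mem_singleton_iff, mem_univ_pi, mem_Ico]
  constructor
  · intro h i
    have hi : ⌊z i / δ⌋ = x i := by rw [← latticeApprox_toLp_apply, h]
    rw [Int.floor_eq_iff] at hi
    constructor
    · have := (le_div_iff₀ hδ).1 hi.1; linarith
    · have := (div_lt_iff₀ hδ).1 hi.2; linarith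
  · intro h
    funext i
    rw [latticeApprox_toLp_apply, Int.floor_eq_iff]
    obtain ⟨h1, h2⟩ := h i
    exact ⟨(le_div_iff₀ hδ).2 (by linarith), (div_lt_iff₀ hδ).2 (by linarith)⟩

/-- Each cell has volume `δ³`. -/
theorem volume_floorMap_preimage_singleton {δ : ℝ} (hδ : 0 < δ) (x : Site 3) :
    volume ((fun z : Fin 3 → ℝ => latticeApprox δ (WithLp.toLp 2 z)) ⁻¹' {x}) =
      ENNReal.ofReal (δ ^ 3) := by
  rw [floorMap_preimage_singleton hδ, volume_pi_pi]
  simp only [Real.volume_Ico]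
  have h : ∀ i : Fin 3, ENNReal.ofReal (δ * ((x i : ℝ) + 1) - δ * (x i : ℝ)) = ENNReal.ofReal δ :=
    fun i => by ring_nf
  simp only [h, Finset.prod_const, Finset.card_univ, Fintype.card_fin]
  rw [ENNReal.ofReal_pow hδ.le]

/-- **The push-forward of Lebesgue measure under the rounding map is `δ³ ·` counting measure.** -/
theorem map_floorMap_volume {δ : ℝ} (hδ : 0 < δ) :
    Measure.map (fun z : Fin 3 → ℝ => latticeApprox δ (WithLp.toLp 2 z)) volume =
      ENNReal.ofReal (δ ^ 3) • Measure.count := by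
  refine Measure.ext_of_singleton fun x => ?_
  rw [Measure.map_apply (measurable_floorMap δ) (measurableSet_singleton x),
    volume_floorMap_preimage_singleton hδ, Measure.smul_apply, Measure.count_singleton,
    smul_eq_mul, mul_one]

/-- **Lattice sums are integrals**: `∫ f([z/δ]) dz = δ³ ∑ₓ f(x)` for absolutely summable `f`. -/
theorem integral_comp_floorMap {δ : ℝ} (hδ : 0 < δ) {f : Site 3 → ℝ}
    (hf : Summable fun x => ‖f x‖) :
    ∫ z : Fin 3 → ℝ, f (latticeApprox δ (WithLp.toLp 2 z)) = δ ^ 3 * ∑' x, f x := by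
  have hint : Integrable f (Measure.count : Measure (Site 3)) := integrable_count_iff.2 hf
  have hint' : Integrable f (ENNReal.ofReal (δ ^ 3) • (Measure.count : Measure (Site 3))) :=
    hint.smul_measure ENNReal.ofReal_ne_top
  have h1 : ∫ z : Fin 3 → ℝ, f (latticeApprox δ (WithLp.toLp 2 z)) =
      ∫ x, f x ∂(Measure.map (fun z : Fin 3 → ℝ => latticeApprox δ (WithLp.toLp 2 z)) volume) := by
    rw [integral_map (measurable_floorMap δ).aemeasurable]
    exact (measurable_of_countable f).aestronglyMeasurable
  rw [h1, map_floorMap_volume hδ, integral_smul_measure, integral_countable hint,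
    ENNReal.toReal_ofReal (by positivity), smul_eq_mul]
  congr 1
  refine tsum_congr fun x => ?_
  rw [measureReal_def, Measure.count_singleton, ENNReal.toReal_one, one_smul]

/-- The rounding moves points by at most `δ` in sup norm: `‖δ[z/δ] - z‖ ≤ δ` (`δ > 0`). -/
theorem norm_smul_floorMap_sub_le {δ : ℝ} (hδ : 0 < δ) (z : Fin 3 → ℝ) :
    ‖(δ • fun i => ((latticeApprox δ (WithLp.toLp 2 z) i : ℤ) : ℝ)) - z‖ ≤ δ := by
  rw [pi_norm_le_iff_of_nonneg hδ.le]
  intro i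
  simp only [Pi.sub_apply, Pi.smul_apply, smul_eq_mul, latticeApprox_toLp_apply, Real.norm_eq_abs]
  have h1 := Int.floor_le (z i / δ)
  have h2 := Int.lt_floor_add_one (z i / δ)
  rw [abs_le]
  constructor
  · have : δ * (z i / δ) < δ * ((⌊z i / δ⌋ : ℝ) + 1) := mul_lt_mul_of_pos_left h2 hδ
    rw [mul_div_cancel₀ _ hδ.ne'] at this
    linarith
  · have : δ * (⌊z i / δ⌋ : ℝ) ≤ δ * (z i / δ) := mul_le_mul_of_nonneg_left h1 hδ.le
    rw [mul_div_cancel₀ _ hδ.ne'] at this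
    linarith

/-- The sup norm of a lattice point read in `ℝ³` is its lattice norm. -/
theorem norm_intCast_eq (x : Site 3) : ‖(fun i => ((x i : ℤ) : ℝ))‖ = ‖x‖ := by
  simp only [Pi.norm_def]
  congr 1

/-- Only finitely many lattice points `x` have `δ x` in a given ball (`δ > 0`). -/
theorem finite_smul_mem_closedBall {δ : ℝ} (hδ : 0 < δ) (w : Fin 3 → ℝ) (b : ℝ) :
    {x : Site 3 | (δ • fun i => ((x i : ℤ) : ℝ)) ∈ Metric.closedBall w b}.Finite := by
  obtain ⟨N, hN⟩ := exists_nat_ge ((‖w‖ + b) / δ)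
  refine (box 3 N).finite_toSet.subset fun x hx => ?_
  simp only [mem_setOf_eq, Metric.mem_closedBall] at hx
  have hnorm : ‖(δ • fun i => ((x i : ℤ) : ℝ))‖ ≤ ‖w‖ + b := by
    calc ‖(δ • fun i => ((x i : ℤ) : ℝ))‖ ≤ ‖(δ • fun i => ((x i : ℤ) : ℝ)) - w‖ + ‖w‖ :=
          norm_le_norm_sub_add _ _
      _ ≤ b + ‖w‖ := by rw [← dist_eq_norm]; linarith
      _ = ‖w‖ + b := add_comm _ _
  rw [norm_smul, Real.norm_eq_abs, abs_of_pos hδ, norm_intCast_eq] at hnorm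
  have hxN : ‖x‖ ≤ N := by
    have : ‖x‖ ≤ (‖w‖ + b) / δ := by rw [le_div_iff₀ hδ, mul_comm]; exact hnorm
    exact this.trans hN
  rw [Finset.mem_coe, mem_box]
  intro i
  have hi : |((x i : ℤ) : ℝ)| ≤ N := by
    have := norm_le_pi_norm x i
    rw [Int.norm_eq_abs] at this
    exact this.trans hxN
  rw [abs_le] at hi
  constructor
  · exact_mod_cast hi.1
  · exact_mod_cast hi.2

/-- A lattice function cut off to the lattice points of a bounded region is absolutely summable. -/
theorem summable_norm_ite_mem {δ : ℝ} (hδ : 0 < δ) {U : Set (Fin 3 → ℝ)} {w : Fin 3 → ℝ} {b : ℝ}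
    (hU : U ⊆ Metric.closedBall w b) (f : Site 3 → ℝ) [DecidablePred (· ∈ U)] :
    Summable fun x : Site 3 =>
      ‖if (δ • fun i => ((x i : ℤ) : ℝ)) ∈ U then f x else 0‖ := by
  refine summable_of_hasFiniteSupport ((finite_smul_mem_closedBall hδ w b).subset fun x hx => ?_)
  rw [Function.mem_support] at hx
  by_contra h
  exact hx (by rw [if_neg (fun h' => h (hU h')), norm_zero])

/-- **Lattice sums over a region as integrals over the rounded region**: for `δ > 0`,
`δ³ ∑_{x : δx ∈ U} f(x) = ∫ 1_U(δ[z/δ]) f([z/δ]) dz`. -/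
theorem tsum_ite_mem_eq_integral {δ : ℝ} (hδ : 0 < δ) {U : Set (Fin 3 → ℝ)} {w : Fin 3 → ℝ}
    {b : ℝ} (hU : U ⊆ Metric.closedBall w b) (f : Site 3 → ℝ) [DecidablePred (· ∈ U)] :
    δ ^ 3 * ∑' x : Site 3, (if (δ • fun i => ((x i : ℤ) : ℝ)) ∈ U then f x else 0) =
      ∫ z : Fin 3 → ℝ, (if (δ • fun i => ((latticeApprox δ (WithLp.toLp 2 z) i : ℤ) : ℝ)) ∈ U
        then f (latticeApprox δ (WithLp.toLp 2 z)) else 0) := by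
  rw [← integral_comp_floorMap hδ (summable_norm_ite_mem hδ hU f)]

end Summit.CriticalPhenomena.Ising3DConformalLimit.Theorems.HarmonicMomentsIsotropy.LatticeSums

end
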